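import Summits.QuantumFields.BalabanUV.Beta.GAN24.ClosedFormRateOfParts

/-!
# `BalabanUV.Beta.GAN24.ClosedFormRateM` — binder row G-an2-4 / (CONV-C), road P1-fibre at RELATIVE BLOCKING `Lc^m` («KFIB-RATIO*», part A):
# the plug form of the one-step difference of the closed-form fibre function of the (j, m)-RESOLVENT FAMILY
# `kFibClosedW (Lc^(j+m)) (Lc^j) (s_f j) (s_m j)` (road FP's X1m-K in finite-matrix form, `PerfectResolventFibre.RealRateKM`)

NOT IN PRINT; OUR PROOF ATTEMPT.  HONEST FRAMING (cell contract, verbatim): «discharging `BetaPertH` makes Bałaban's UV stability UNCONDITIONAL — a real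
constructive-QFT result; it is NOT the continuum limit and NOT the Clay problem.»  HONEST DEPENDENCY (verbatim): «continuum YM on T⁴ ⇐ BetaPertH ∧ nine spine
estimates (0/9 proved); BetaPertH ⇐ (D1) ∧ (D4) ∧ CAP+tail; G-an2-4 gates asym, D1 and NE2/3/4.»

WHY.  Road P1's row L11 (`FibreRate.realRateK`) proves the `j`-geometric real-zone rate of the ONE-STEP fibre functions `kFib … j = kFibW (Lc^(j+1)) (Lc^j) …`
(relative blocking `Lc`).  Road FP (binder D1) needs the same for the (j, m)-family `kFibM … m j = kFibW (Lc^(j+m)) (Lc^j) (s_f j) (s_m j)` (gan24-p3-g13's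
`PerfectResolventFibre`, shape `RealRateKM d Lc m c θ`; LOCATED remainder CLAIMS l.11347: «road P1's Part B re-run at ratio `Lc^m`»).  The two-level pairs are
`(N′, M′) = (Lc^(j+1+m), Lc^(j+1)) = (N·Lc, M·Lc)` against `(N, M) = (Lc^(j+m), Lc^j)`, `N = M·Lc^m`.  This file is the `m`-analogue of leaf-17's
`ClosedFormRateOfParts` §2–§3 [folklore, same proofs]: the multiplier-leg Bloch phases see only the RELATIVE blocking (`quo (Lc^(j+m)) (Lc^j • x′) = quo (Lc^m) x′`,
level-free), so at real momentum the four leg differences reduce to the unit-scaled differences of the alias sums ∕ multiplier responses, and assembled bounds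
`C_ff, C_fm, C_mf, C_mm` of those give `‖Δ‖ ≤ C_ff + C_fm + C_mf + C_mm` for every leg pair (`norm_kFibClosedW_succ_sub_le_of_parts_M`).

[folklore] throughout; exact finite algebra over typer row T00's `AliasObjects.kFibClosedW` and `ClosedFormBoundOfParts.kFibClosedW_fm∕mf∕mm`,
`FibreStepResidues.norm_cphase_ofRealVec` BY NAME; 0 def, 0 cited fact, 0 `def … : Prop`, 0 sorry, no wall binder, no unit re-typed (units `s_f, s_m : ℕ → ℝ` free).
HONEST: NOT summit progress; an unfolding∕plug lemma; discharges NOTHING of (CONV-C); NOT «X1m closed», NEVER «G-an2-4 closed»; NOT BetaPertH, NOT continuum, NOT Clay.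

Unit `b2b-balaban-gan24-formalise-leaf-06` (G-an2-4 formalisation swarm, leaf prover 06), gen 11, 2026-08-20; INTENT «KFIB-RATIO*» CLAIMS l.11491.
-/

noncomputable section

open Complex Finset
open scoped BigOperators
open Literature.Probability.LatticeModels (TorusSite)
open Literature.MathematicalPhysics.QuantumFieldTheory
open Literature.MathematicalPhysics.QuantumFieldTheory.LatticeForm (quo)
open Literature.MathematicalPhysics.QuantumFieldTheory.Balaban1983to89
open Literature.MathematicalPhysics.QuantumFieldTheory.Balaban1983to89.Beta
open B4Strip (ofRealVec)
open FibreInverseDecay (cphase)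
open OneStepResolventKernel (Fib)
open Summit.QuantumFields.BalabanUV.Beta.GAN24.AliasObjects (kFibClosedW readW Ahat phiSol fhatF eVec)
open Summit.QuantumFields.BalabanUV.Beta.GAN24.FibreStepResidues (norm_cphase_ofRealVec)

namespace Summit.QuantumFields.BalabanUV.Beta.GAN24.ClosedFormRateM

variable {d : ℕ}

/-! ## §1 The multiplier-leg phases see only the relative blocking `Lc^m` -/

section Phase

variable (Lc : ℕ) [NeZero Lc]

/-- [folklore] **`quo (Lc^(j+m)) (Lc^j • x′) = quo (Lc^m) x′`**: the `Lc^(j+m)`-block index of the `Lc^j`-scaled coarse point is its `Lc^m`-block index — the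
same at every level `j` (Euclidean division `(Lc^j·x)/(Lc^j·Lc^m) = x/Lc^m`; `m = 1` is `ClosedFormRateOfParts.quo_step`). -/
theorem quo_pow_add (j m : ℕ) (x' : Fin (d + 1) → ℤ) : quo (Lc ^ (j + m)) (((Lc ^ j : ℕ) : ℤ) • x') = quo (Lc ^ m) x' := by
  funext i
  have hpos : (0 : ℤ) < (Lc : ℤ) ^ j := pow_pos (by exact_mod_cast Nat.pos_of_ne_zero (NeZero.ne Lc)) j
  simp only [quo, Pi.smul_apply, smul_eq_mul]
  push_cast
  rw [pow_add, Int.mul_ediv_mul_of_pos _ _ hpos]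

/-- [folklore] The difference of two block indices is level-free as well. -/
theorem quo_pow_add_sub (j m : ℕ) (x' y' : Fin (d + 1) → ℤ) :
    quo (Lc ^ (j + m)) (((Lc ^ j : ℕ) : ℤ) • x') - quo (Lc ^ (j + m)) (((Lc ^ j : ℕ) : ℤ) • y') = quo (Lc ^ m) x' - quo (Lc ^ m) y' := by
  rw [quo_pow_add, quo_pow_add]

/-- [folklore] The mf phase at level `j` is `e^{ip·quo (Lc^m) x′}`. -/
theorem cphase_mf_pow_add (j m : ℕ) (x' : Fin (d + 1) → ℤ) (p : Fin (d + 1) → ℂ) :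
    cphase (quo (Lc ^ (j + m)) (((Lc ^ j : ℕ) : ℤ) • x')) p = cphase (quo (Lc ^ m) x') p := by
  rw [quo_pow_add]

/-- [folklore] The fm phase at level `j` is `e^{−ip·quo (Lc^m) y′}`. -/
theorem cphase_fm_pow_add (j m : ℕ) (y' : Fin (d + 1) → ℤ) (p : Fin (d + 1) → ℂ) :
    cphase (-quo (Lc ^ (j + m)) (((Lc ^ j : ℕ) : ℤ) • y')) p = cphase (-quo (Lc ^ m) y') p := by
  rw [quo_pow_add]

/-- [folklore] The mm phase at level `j` is `e^{ip·(quo (Lc^m) x′ − quo (Lc^m) y′)}`. -/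
theorem cphase_mm_pow_add (j m : ℕ) (x' y' : Fin (d + 1) → ℤ) (p : Fin (d + 1) → ℂ) :
    cphase (quo (Lc ^ (j + m)) (((Lc ^ j : ℕ) : ℤ) • x') - quo (Lc ^ (j + m)) (((Lc ^ j : ℕ) : ℤ) • y')) p =
      cphase (quo (Lc ^ m) x' - quo (Lc ^ m) y') p := by
  rw [quo_pow_add_sub]

end Phase

/-! ## §2 The four leg differences of the (j, m)-family's closed form -/

section Legs

variable (Lc : ℕ) [NeZero Lc] (sf sm : ℕ → ℝ) (m j : ℕ)

/-- [folklore] `Lc^(j+m) ≤ Lc^(j+1+m)` (`Lc ≥ 1`): the level-`j` label box embeds in the level-`(j+1)` box. -/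
theorem pow_add_step_le : Lc ^ (j + m) ≤ Lc ^ (j + 1 + m) :=
  Nat.pow_le_pow_right (Nat.pos_of_ne_zero (NeZero.ne Lc)) (by omega)

omit [NeZero Lc] in
/-- [folklore] `Lc^(j+1+m) = Lc^(j+m)·Lc`: the next level of the (j, m)-family is ONE blocking step above. -/
theorem pow_succ_add_eq : Lc ^ (j + 1 + m) = Lc ^ (j + m) * Lc := by
  rw [show j + 1 + m = j + m + 1 by omega, pow_succ]

/-- [folklore] **ff DIFFERENCE** (unfolding, every complex `p`). -/
theorem kFibClosedW_succ_sub_ff (κ l : Fin (d + 1)) (x' y' : Fin (d + 1) → ℤ) (p : Fin (d + 1) → ℂ) :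
    kFibClosedW (Lc ^ (j + 1 + m)) (Lc ^ (j + 1)) (sf (j + 1)) (sm (j + 1)) (Sum.inl κ) x' (Sum.inl l) y' p -
        kFibClosedW (Lc ^ (j + m)) (Lc ^ j) (sf j) (sm j) (Sum.inl κ) x' (Sum.inl l) y' p =
      ((sf (j + 1) * sf (j + 1) : ℝ) : ℂ) * ∑ c', readW (Lc ^ (j + 1 + m)) (Lc ^ (j + 1)) p c' κ x' *
          Ahat (Lc ^ (j + 1 + m)) p (fhatF (Lc ^ (j + 1 + m)) (Lc ^ (j + 1)) p l y') 0 c' κ -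
      ((sf j * sf j : ℝ) : ℂ) * ∑ c, readW (Lc ^ (j + m)) (Lc ^ j) p c κ x' *
          Ahat (Lc ^ (j + m)) p (fhatF (Lc ^ (j + m)) (Lc ^ j) p l y') 0 c κ := rfl

/-- [folklore] **fm DIFFERENCE**: the common phase `e^{−ip·quo (Lc^m) y′}` factors out (§1). -/
theorem kFibClosedW_succ_sub_fm (κ l : Fin (d + 1)) (x' y' : Fin (d + 1) → ℤ) (p : Fin (d + 1) → ℂ) :
    kFibClosedW (Lc ^ (j + 1 + m)) (Lc ^ (j + 1)) (sf (j + 1)) (sm (j + 1)) (Sum.inl κ) x' (Sum.inr l) y' p -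
        kFibClosedW (Lc ^ (j + m)) (Lc ^ j) (sf j) (sm j) (Sum.inl κ) x' (Sum.inr l) y' p =
      cphase (-quo (Lc ^ m) y') p *
        (((sf (j + 1) * sm (j + 1) : ℝ) : ℂ) * ∑ c', readW (Lc ^ (j + 1 + m)) (Lc ^ (j + 1)) p c' κ x' *
            Ahat (Lc ^ (j + 1 + m)) p 0 (eVec l) c' κ -
          ((sf j * sm j : ℝ) : ℂ) * ∑ c, readW (Lc ^ (j + m)) (Lc ^ j) p c κ x' * Ahat (Lc ^ (j + m)) p 0 (eVec l) c κ) := by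
  rw [ClosedFormBoundOfParts.kFibClosedW_fm, ClosedFormBoundOfParts.kFibClosedW_fm, cphase_fm_pow_add Lc (j + 1) m, cphase_fm_pow_add Lc j m]
  ring

/-- [folklore] **mf DIFFERENCE**: the common phase `e^{ip·quo (Lc^m) x′}` factors out. -/
theorem kFibClosedW_succ_sub_mf (κ l : Fin (d + 1)) (x' y' : Fin (d + 1) → ℤ) (p : Fin (d + 1) → ℂ) :
    kFibClosedW (Lc ^ (j + 1 + m)) (Lc ^ (j + 1)) (sf (j + 1)) (sm (j + 1)) (Sum.inr κ) x' (Sum.inl l) y' p -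
        kFibClosedW (Lc ^ (j + m)) (Lc ^ j) (sf j) (sm j) (Sum.inr κ) x' (Sum.inl l) y' p =
      cphase (quo (Lc ^ m) x') p *
        (((sm (j + 1) * sf (j + 1) : ℝ) : ℂ) * phiSol (Lc ^ (j + 1 + m)) p (fhatF (Lc ^ (j + 1 + m)) (Lc ^ (j + 1)) p l y') 0 κ -
          ((sm j * sf j : ℝ) : ℂ) * phiSol (Lc ^ (j + m)) p (fhatF (Lc ^ (j + m)) (Lc ^ j) p l y') 0 κ) := by
  rw [ClosedFormBoundOfParts.kFibClosedW_mf, ClosedFormBoundOfParts.kFibClosedW_mf, cphase_mf_pow_add Lc (j + 1) m, cphase_mf_pow_add Lc j m]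
  ring

/-- [folklore] **mm DIFFERENCE**: the common phase `e^{ip·(quo (Lc^m) x′ − quo (Lc^m) y′)}` factors out. -/
theorem kFibClosedW_succ_sub_mm (κ l : Fin (d + 1)) (x' y' : Fin (d + 1) → ℤ) (p : Fin (d + 1) → ℂ) :
    kFibClosedW (Lc ^ (j + 1 + m)) (Lc ^ (j + 1)) (sf (j + 1)) (sm (j + 1)) (Sum.inr κ) x' (Sum.inr l) y' p -
        kFibClosedW (Lc ^ (j + m)) (Lc ^ j) (sf j) (sm j) (Sum.inr κ) x' (Sum.inr l) y' p =
      cphase (quo (Lc ^ m) x' - quo (Lc ^ m) y') p *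
        (((sm (j + 1) * sm (j + 1) : ℝ) : ℂ) * phiSol (Lc ^ (j + 1 + m)) p 0 (eVec l) κ -
          ((sm j * sm j : ℝ) : ℂ) * phiSol (Lc ^ (j + m)) p 0 (eVec l) κ) := by
  rw [ClosedFormBoundOfParts.kFibClosedW_mm, ClosedFormBoundOfParts.kFibClosedW_mm, cphase_mm_pow_add Lc (j + 1) m, cphase_mm_pow_add Lc j m]
  ring

end Legs

/-! ## §3 The plug form at real momentum -/

section Real

variable (Lc : ℕ) [NeZero Lc] (sf sm : ℕ → ℝ) (m j : ℕ)

/-- [folklore] **UNIFORM PLUG FORM FOR THE ONE-STEP DIFFERENCE OF THE (j, m)-FAMILY** at real momentum `q`: if the assembled unit-scaled two-level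
differences of the ff alias sums are `≤ C_ff`, of the fm alias sums `≤ C_fm`, of the multiplier responses to a force `≤ C_mf` and to a constraint `≤ C_mm`
(all four nonnegative), then for EVERY leg pair
`‖kFibClosedW (Lc^(j+1+m)) (Lc^(j+1)) (s_f (j+1)) (s_m (j+1)) a x′ b y′ (ofRealVec q) − kFibClosedW (Lc^(j+m)) (Lc^j) (s_f j) (s_m j) a x′ b y′ (ofRealVec q)‖
≤ C_ff + C_fm + C_mf + C_mm` (`m = 1`: `ClosedFormRateOfParts.norm_kFibClosed_succ_sub_le_of_parts`). -/
theorem norm_kFibClosedW_succ_sub_le_of_parts_M (q : Fin (d + 1) → ℝ) {Cff Cfm Cmf Cmm : ℝ}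
    (hCff : 0 ≤ Cff) (hCfm : 0 ≤ Cfm) (hCmf : 0 ≤ Cmf) (hCmm : 0 ≤ Cmm)
    (hff : ∀ κ l x' y', ‖((sf (j + 1) * sf (j + 1) : ℝ) : ℂ) * ∑ c', readW (Lc ^ (j + 1 + m)) (Lc ^ (j + 1)) (ofRealVec q) c' κ x' *
          Ahat (Lc ^ (j + 1 + m)) (ofRealVec q) (fhatF (Lc ^ (j + 1 + m)) (Lc ^ (j + 1)) (ofRealVec q) l y') 0 c' κ -
        ((sf j * sf j : ℝ) : ℂ) * ∑ c, readW (Lc ^ (j + m)) (Lc ^ j) (ofRealVec q) c κ x' *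
          Ahat (Lc ^ (j + m)) (ofRealVec q) (fhatF (Lc ^ (j + m)) (Lc ^ j) (ofRealVec q) l y') 0 c κ‖ ≤ Cff)
    (hfm : ∀ κ l x', ‖((sf (j + 1) * sm (j + 1) : ℝ) : ℂ) * ∑ c', readW (Lc ^ (j + 1 + m)) (Lc ^ (j + 1)) (ofRealVec q) c' κ x' *
          Ahat (Lc ^ (j + 1 + m)) (ofRealVec q) 0 (eVec l) c' κ -
        ((sf j * sm j : ℝ) : ℂ) * ∑ c, readW (Lc ^ (j + m)) (Lc ^ j) (ofRealVec q) c κ x' * Ahat (Lc ^ (j + m)) (ofRealVec q) 0 (eVec l) c κ‖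
        ≤ Cfm)
    (hmf : ∀ κ l y', ‖((sm (j + 1) * sf (j + 1) : ℝ) : ℂ) *
          phiSol (Lc ^ (j + 1 + m)) (ofRealVec q) (fhatF (Lc ^ (j + 1 + m)) (Lc ^ (j + 1)) (ofRealVec q) l y') 0 κ -
        ((sm j * sf j : ℝ) : ℂ) * phiSol (Lc ^ (j + m)) (ofRealVec q) (fhatF (Lc ^ (j + m)) (Lc ^ j) (ofRealVec q) l y') 0 κ‖ ≤ Cmf)
    (hmm : ∀ κ l, ‖((sm (j + 1) * sm (j + 1) : ℝ) : ℂ) * phiSol (Lc ^ (j + 1 + m)) (ofRealVec q) 0 (eVec l) κ -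
        ((sm j * sm j : ℝ) : ℂ) * phiSol (Lc ^ (j + m)) (ofRealVec q) 0 (eVec l) κ‖ ≤ Cmm)
    (a : Fib d) (x' : Fin (d + 1) → ℤ) (b : Fib d) (y' : Fin (d + 1) → ℤ) :
    ‖kFibClosedW (Lc ^ (j + 1 + m)) (Lc ^ (j + 1)) (sf (j + 1)) (sm (j + 1)) a x' b y' (ofRealVec q) -
        kFibClosedW (Lc ^ (j + m)) (Lc ^ j) (sf j) (sm j) a x' b y' (ofRealVec q)‖ ≤ Cff + Cfm + Cmf + Cmm := by
  rcases a with κ | κ <;> rcases b with l | l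
  · rw [kFibClosedW_succ_sub_ff]
    linarith [hff κ l x' y']
  · rw [kFibClosedW_succ_sub_fm, norm_mul, norm_cphase_ofRealVec, one_mul]
    linarith [hfm κ l x']
  · rw [kFibClosedW_succ_sub_mf, norm_mul, norm_cphase_ofRealVec, one_mul]
    linarith [hmf κ l y']
  · rw [kFibClosedW_succ_sub_mm, norm_mul, norm_cphase_ofRealVec, one_mul]
    linarith [hmm κ l]

end Real

end Summit.QuantumFields.BalabanUV.Beta.GAN24.ClosedFormRateM

end
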